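import Literature.IUT.HodgeArakelov.CuspidalInertiaDataNonVacuity
import Literature.IUT.HodgeArakelov.LabCuspStructureNonVacuity
import Literature.IUT.HodgeArakelov.PlusMinusTowerNonVacuity
import HarnessLib

/-!
# [IUTchII] Def 2.3 (ii)/(iii): ABSOLUTE non-vacuity of `CuspidalInertiaData`, and why the degenerate `±`-tower carries NO
# `LabCuspStructure` (NV-L6 rows «CuspidalInertiaData», «LabCuspStructure» — sequel)

S. Mochizuki, *Inter-universal Teichmüller Theory II*, kurims manuscript (Dec. 2020), §2, Def 2.3 (ii)/(iii) pp. 67–68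
[cite: Mochizuki2012, II Def 2.3 (ii)(iii) pp.67–68]. abc-iut cell, NV-L6 WAVE (abc-iut-L6-lead §F v1.18p), seat abc-iut-w5-d028;
PROOF-ONLY (no `def`/`instance`/`structure`). Composes three landed files and restates nothing: this seat's
`CuspidalInertiaDataNonVacuity` (p419147: `nonempty_degenerate` for EVERY tower) and `LabCuspStructureNonVacuity` (p419304:
`nonempty_iff_nonempty_equiv`, `not_nonempty_of_subsingleton`), and abc-iut-w5-d063's `PlusMinusTowerNonVacuity` (p420440:
`PlusMinusTower.nonempty_degenerate : ∃ S P T, Nonempty (PlusMinusTower T)`, DEGENERATE — all tempered groups trivial).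

* `CuspidalInertiaData.exists_nonempty_degenerate` — ABSOLUTE (closed) witness: `∃ S P T (W : PlusMinusTower T),
  Nonempty (CuspidalInertiaData W)`. Label DEGENERATE (w5-d063's tower + the «every subgroup» predicate).
* `LabCuspStructure.not_nonempty_of_piV_eq_bot` — over ANY tower whose image `Π_v ⊆ Π̂^cor_v` is trivial and ANY cuspidal-inertia
  notion `C`, NO `LabCuspStructure C` exists: the one law `I ≤ Π_v` forces every cuspidal inertia group of `Π_v` to be `1`, so
  `LabCusp^±(Π_v)` has at most one element, while `toFl : LabCusp^±(Π_v) ≃ 𝔽_l` needs `l ≥ 2` of them (`S.l` is prime).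
* `LabCuspStructure.not_nonempty_of_subsingleton_group` — in particular over any tower on a TRIVIAL `Π_v = Π^tp_{X̲̲_v}` (the case of
  p420440's degenerate setting: `Π_v = 1`).

CONSEQUENCE for §4(iii) (honest): the «LabCuspStructure» row cannot be closed by the degenerate towers now in the tree; an absolute
witness needs a tower whose `Π_v` carries at least `l` cuspidal inertia groups with pairwise non-`Π^±_v`-conjugate normalisers —
i.e. the GENUINE cusp combinatorics of `X̲̲_v → X_v` ([IUTchI] Def 6.1 (iii) «`LabCusp(†𝒟_v) ≅ 𝔽_l`»; L5 `StableCurveTemperedData`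
completions via `PlusMinusTowerStableCurveBridge`) — NV-BLOCKED there, as recorded in p419304. Nothing of the series is asserted;
consistency ≠ endorsement; no side taken on [IUTchIII] Cor. 3.12.
-/

namespace Literature.IUT.HodgeArakelov

open Literature.IUT.HodgeTheaters

universe u

/-- **IUTchII:Def2.3(ii)** ABSOLUTE (closed) non-vacuity of the interface `CuspidalInertiaData`: some `±`-tower carries a
cuspidal-inertia notion — abc-iut-w5-d063's DEGENERATE tower (p420440) with the DEGENERATE «every subgroup of `Π`» predicate
(p419147). degenerate label. [cite: Mochizuki2012, II Def 2.3 (ii) pp.67–68] -/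
theorem CuspidalInertiaData.exists_nonempty_degenerate :
    ∃ (S : BadPlaceSetting.{0}) (P : TopGroup.{0}) (T : TemperedCoverings S P) (W : PlusMinusTower T),
      Nonempty (CuspidalInertiaData W) := by
  obtain ⟨S, P, T, ⟨W⟩⟩ := PlusMinusTower.nonempty_degenerate
  exact ⟨S, P, T, W, CuspidalInertiaData.nonempty_degenerate W⟩

variable {S : BadPlaceSetting.{u}} {P : TopGroup.{u}} {T : TemperedCoverings S P} {W : PlusMinusTower T}

/-- **IUTchII:Def2.3(iii)** Over a tower whose tempered image `Π_v ⊆ Π̂^cor_v` is TRIVIAL, and for ANY cuspidal-inertia notion `C`,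
there is NO `LabCuspStructure C`: every cuspidal inertia group of `Π_v` is `≤ Π_v = 1` (the law `le_of_isCuspidalInertia`), so
`LabCusp^±(Π_v)` has at most one element, whereas `toFl : LabCusp^±(Π_v) ≃ 𝔽_l` with `l` prime needs at least two.
[cite: Mochizuki2012, II Def 2.3 (iii) p.68] -/
theorem LabCuspStructure.not_nonempty_of_piV_eq_bot (hV : W.piV = ⊥) (C : CuspidalInertiaData W) :
    ¬ Nonempty (LabCuspStructure C) := by
  haveI : Subsingleton (LabCuspPM C W.piV W.piPM) := by
    refine ⟨fun a b => ?_⟩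
    induction a using Quot.ind with
    | mk I =>
      induction b using Quot.ind with
      | mk J =>
        have hI : I.1 = ⊥ := le_bot_iff.mp (hV ▸ C.le_of_isCuspidalInertia I.2)
        have hJ : J.1 = ⊥ := le_bot_iff.mp (hV ▸ C.le_of_isCuspidalInertia J.2)
        have : I = J := Subtype.ext (hI.trans hJ.symm)
        rw [this]
  exact LabCuspStructure.not_nonempty_of_subsingleton S.l_prime.two_le

/-- **IUTchII:Def2.3(iii)** … in particular over any tower on a TRIVIAL tempered group `Π_v = Π^tp_{X̲̲_v}` (`Subsingleton P`) — the case
of abc-iut-w5-d063's degenerate setting p420440 («all tempered / Galois groups TRIVIAL») — no `LabCuspStructure` exists for any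
cuspidal-inertia notion: the absolute «LabCuspStructure» witness is NV-BLOCKED on a tower with `≥ l` label classes.
[cite: Mochizuki2012, II Def 2.3 (iii) p.68] -/
theorem LabCuspStructure.not_nonempty_of_subsingleton_group [Subsingleton P] (C : CuspidalInertiaData W) :
    ¬ Nonempty (LabCuspStructure C) := by
  refine LabCuspStructure.not_nonempty_of_piV_eq_bot ?_ C
  refine le_bot_iff.mp fun x hx => ?_
  obtain ⟨y, rfl⟩ := hx
  rw [Subsingleton.elim y 1, map_one]
  exact Subgroup.one_mem _

end Literature.IUT.HodgeArakelov
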